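import Literature.RingTheory.KrullDimension.AffineDimension
import Mathlib.RingTheory.Smooth.Field
import Mathlib.RingTheory.Etale.Kaehler
import Mathlib.RingTheory.Kaehler.Polynomial
import Mathlib.RingTheory.Localization.Free
import Mathlib.RingTheory.Extension.Cotangent.Basic
import Mathlib.Algebra.MvPolynomial.PDeriv
import Mathlib.Algebra.DualNumber
import HarnessLib

/-!
# Tangent spaces of affine varieties over a perfect field: dimension and coordinates

Standard commutative algebra behind Springer, *Linear Algebraic Groups* (2nd ed.), 4.1–4.3
(tangent spaces, simple points), proved here from Mathlib's Kähler differentials, in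
continuation of `AffineDimension.lean` (`Literature.RingTheory.KrullDimension.ringKrullDim_eq_trdeg`: `dim A = trdeg_k A` for
affine domains). Namespace `Literature`.

## Dimension (Springer 4.2.9–4.2.11, 4.3.2–4.3.3)

* `Literature.RingTheory.KrullDimension.free_and_finrank_kaehlerDifferential_of_isSeparable` — if `K ⊇ k` has a finite separating
  transcendence basis `x : ι → K`, then `Ω_{K/k}` is a `K`-vector space of dimension `|ι|`
  (Springer 4.2.9 (ii), the "if" direction; Mathlib: the top extension is formally étale,
  `KaehlerDifferential.tensorKaehlerEquivOfFormallyEtale`, and `Ω_{k[X_i]/k}` is free on the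
  `dX_i`, `KaehlerDifferential.mvPolynomialBasis`);
* `Literature.RingTheory.KrullDimension.free_and_finrank_kaehlerDifferential_of_perfectField` — hence
  `dim_K Ω_{K/k} = trdeg_k K` for `K` finitely generated over a *perfect* field `k`
  (Springer 4.2.11 with 4.2.10: such `K` are separably generated; Mathlib
  `exists_isTranscendenceBasis_and_isSeparable_of_perfectField`);
* `Literature.RingTheory.KrullDimension.free_and_finrank_kaehlerDifferential_fractionRing`,
  `Literature.RingTheory.KrullDimension.exists_free_kaehlerDifferential_away` — for an affine domain `A` over a perfect field,
  `dim_{k(A)} Ω_{k(A)/k} = dim A`, and `Ω_{A/k}` becomes free of rank `dim A` on a non-empty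
  principal open subset `D(r)`, `r ≠ 0` (Springer 4.3.3, proof: "`dim_{k(X)} Ω_{k(X)/k} = e`
  … `e = n - r`"; generic freeness is Mathlib's
  `Module.FinitePresentation.exists_free_localizedModule_powers`);
* `Literature.PointModule φ` — the `A`-module `k_x` of a `k`-rational point `x = φ : A →ₐ[k] k`
  (Springer 4.1.2), so that `Derivation k A (PointModule φ)` **is** the tangent space
  `T_x X = Der_k(k[X], k_x)` of Springer 4.1.3; `Literature.pointDerivations φ ⊆ Hom_k(A, k)` — the
  same space presented as the linear forms `D` with `D(ab) = a(x) D(b) + b(x) D(a)`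
  (`pointDerivationsEquiv`), the form used for computations in coordinates;
* `Literature.RingTheory.KrullDimension.exists_finrank_derivation_pointModule_eq`, `Literature.RingTheory.KrullDimension.exists_finrank_pointDerivations_eq` —
  **the theorem**: for an affine domain `A` over a perfect field `k` there is `r ≠ 0` in `A`
  such that at every `k`-point `x` with `r(x) ≠ 0` the tangent space `Der_k(A, k_x)` is
  finite-dimensional of dimension `dim A` (Springer 4.3.3 (ii)–(iii) in the form "on a non-empty
  open subset the points are simple", 4.1.7; via `T_x X ≅ Hom_A(Ω_{A/k}, k_x)`, Springer 4.3.2,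
  Mathlib `KaehlerDifferential.linearMapEquivDerivation`).

## Coordinates (Springer 4.1.2–4.1.3)

* `Literature.pointDerivations.precomp f φ` — the differential `dφ_x : T_x X → T_{φ x} Y` of a morphism
  of affine varieties, i.e. precomposition of point derivations with the comorphism
  `f : k[Y] → k[X]` (Springer 4.1.3); injective when `f` is surjective (closed immersions);
* `Literature.tangentSpaceAt I a ⊆ kⁿ` — for an ideal `I ⊆ k[T_1, …, T_n]` and a point `a ∈ kⁿ`, the
  solutions `v` of the linear equations `∑ᵢ (∂f/∂Tᵢ)(a) vᵢ = 0`, `f ∈ I` (Springer 4.1.2, the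
  "heuristic" tangent space of `V(I)` at `a`);
* `Literature.RingTheory.KrullDimension.pointDerivations.apply_eq_sum_pderiv` — a point derivation `D` of `k[T]` at `a` is
  `D f = ∑ᵢ (∂f/∂Tᵢ)(a) D(Tᵢ)` (Springer 4.1.2, the formula for `D_x`); dually,
  `Literature.RingTheory.KrullDimension.aeval_dualNumberPoint`: `p(a + ε v) = p(a) + ε ∑ᵢ (∂p/∂Tᵢ)(a) vᵢ` in the dual numbers
  `k[ε]` (Springer 4.1.2, 4.1.9 (3));
* `Literature.tangentSpaceAtEquiv : Der_k(k[T]/I, k_a) ≃ tangentSpaceAt I a` for a zero `a` of `I`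
  (Springer 4.1.2–4.1.3: the derivations of `k[T]/I` at `a` are the derivations of `k[T]` at `a`
  vanishing on `I`, and these are given by the vectors `v` above);
* `Literature.RingTheory.KrullDimension.exists_finrank_tangentSpaceAt_eq` — **Springer 4.3.3 (ii) in coordinates**: if `I` is
  prime and `k` is perfect, there is `f ∉ I` such that `dim_k tangentSpaceAt I a = dim k[T]/I`
  for every zero `a` of `I` with `f(a) ≠ 0`.

## The lower bound (Springer 4.1.4, 4.3.3 (iii))

* `Literature.RingTheory.KrullDimension.pointDerivationsEquivCotangentDual` — **Springer 4.1.4**: `T_x = Der_k(B, k_x)` is dual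
  to `𝔪_x/𝔪_x²` (`λ`, `μ` as printed), for any `k`-algebra `B` and rational point `x`; hence
  `dim T_x = dim 𝔪_x/𝔪_x²` and `T_x` is finite-dimensional for Noetherian `B`;
* `Literature.RingTheory.KrullDimension.height_pointIdeal_le_finrank_pointDerivations` — **Springer 4.3.3 (iii) in local form**:
  `height 𝔪_x ≤ dim_k T_x` for Noetherian `B` (Nakayama: `𝔪_x` is a minimal prime of the ideal
  generated by lifts of a basis of `𝔪_x/𝔪_x²`; then Krull's height theorem, Mathlib
  `Ideal.height_le_card_of_mem_minimalPrimes_span`); `Literature.RingTheory.KrullDimension.height_le_finrank_tangentSpaceAt` is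
  the coordinate form.

This is the input of Springer 4.3.7 (i)/4.4.6 (`dim L(G) = dim G`: all points of a connected
algebraic group are simple, by homogeneity) in
`Literature/NumberTheory/Automorphic/LieAlgebraGLDimension.lean`.

## Mathlib

Everything about `Ω` is Mathlib's (`KaehlerDifferential`, with its localisation
`KaehlerDifferential.isLocalizedModule_map`, base change along formally étale maps, the basis
for polynomial rings, finite presentation `Module.FinitePresentation S Ω[S⁄R]`), as are
transcendence bases/degree (`IsTranscendenceBasis`, `Algebra.trdeg`, `trdeg_add_eq`), separable
generation over perfect fields, formally étale algebras (`Algebra.FormallyEtale.of_isSeparable`,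
`.of_isLocalization`, `.comp`), generic freeness, `Module.Basis.constr`, derivations of
polynomial rings (`MvPolynomial.pderiv`, `Derivation.leibniz`) and dual numbers
(`DualNumber`, `TrivSqZeroExt`). Mathlib has no statement linking `dim_K Ω_{K/k}` to `trdeg`, or
tangent spaces to Krull dimension (searched `finrank` + `KaehlerDifferential`, `trdeg` +
`Kaehler`, `tangentSpace` — only for manifolds): those links are what is proved here.

## References

* T. A. Springer, *Linear Algebraic Groups*, 2nd ed., Progress in Mathematics 9, Birkhäuser
  (1998), 4.1.2–4.1.4, 4.1.7, 4.1.9 (3), 4.2.2 (i), 4.2.9–4.2.11, 4.3.2–4.3.3 [SpringerLAG1998].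
* H. Matsumura, *Commutative Ring Theory*, CUP (1986), §26 (separability, Thm 26.2–26.3) and
  Thm 5.6 [Matsumura1987].
-/

noncomputable section

open scoped IntermediateField.algebraAdjoinAdjoin TensorProduct

namespace Literature.RingTheory.KrullDimension

/-! ### `dim_K Ω_{K/k} = trdeg_k K` for separably generated extensions -/

section SeparablyGenerated

variable {k K : Type*} [Field k] [Field K] [Algebra k K]

/-- **Springer 4.2.9 (ii), "if"**: if `x : ι → K` is a finite algebraically independent family
such that `K` is separable (algebraic) over `k(x)`, then `Ω_{K/k}` is free of rank `|ι|` over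
`K`. Proof: `K` is formally étale over the polynomial ring `k[X_i]` (a localisation followed by
a separable algebraic extension), so `Ω_{K/k} = K ⊗ Ω_{k[X]/k}` and the latter is free on the
`dX_i`. [cite: SpringerLAG1998, Thm 4.2.9 (ii)] -/
theorem free_and_finrank_kaehlerDifferential_of_isSeparable {ι : Type*} [Fintype ι] {x : ι → K}
    (hx : AlgebraicIndependent k x)
    [hsep : Algebra.IsSeparable (IntermediateField.adjoin k (Set.range x)) K] :
    Module.Free K Ω[K⁄k] ∧ Module.finrank K Ω[K⁄k] = Fintype.card ι := by
  set P := Algebra.adjoin k (Set.range x) with hP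
  set E := IntermediateField.adjoin k (Set.range x) with hE
  haveI i1 : Algebra.FormallyEtale P E :=
    Algebra.FormallyEtale.of_isLocalization (M := nonZeroDivisors P)
  haveI i2 : Algebra.FormallyEtale E K := Algebra.FormallyEtale.of_isSeparable E K
  haveI i3 : Algebra.FormallyEtale P K := Algebra.FormallyEtale.comp P E K
  -- `K` as an algebra over the polynomial ring `Q = k[X_i]`, through `aeval x : Q ≃ P ⊆ K`
  let Q := MvPolynomial ι k
  let e : Q ≃ₐ[k] P := hx.aevalEquiv
  letI : Algebra Q P := (e : Q →ₐ[k] P).toRingHom.toAlgebra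
  letI : Algebra Q K := ((algebraMap P K).comp (e : Q →ₐ[k] P).toRingHom).toAlgebra
  haveI : IsScalarTower Q P K := IsScalarTower.of_algebraMap_eq (fun q => rfl)
  haveI : IsScalarTower k Q K := IsScalarTower.of_algebraMap_eq (fun c => by
    change algebraMap k K c = algebraMap P K (e (algebraMap k Q c))
    rw [AlgEquiv.commutes]; rfl)
  have e' : Q ≃ₐ[Q] P := { e with commutes' := fun q => rfl }
  haveI : Algebra.FormallyEtale Q P := Algebra.FormallyEtale.of_equiv e'
  haveI : Algebra.FormallyEtale Q K := Algebra.FormallyEtale.comp Q P K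
  let f := KaehlerDifferential.tensorKaehlerEquivOfFormallyEtale k Q K
  have b := KaehlerDifferential.mvPolynomialBasis k ι
  haveI : Module.Free Q Ω[Q⁄k] := Module.Free.of_basis b
  refine ⟨Module.Free.of_equiv f, ?_⟩
  rw [← f.finrank_eq, Module.finrank_baseChange, Module.finrank_eq_card_basis b]

/-- **Springer 4.2.11 with 4.2.9 (ii): over a perfect field `k`, a finitely generated extension
`K` has `dim_K Ω_{K/k} = trdeg_k K`** (such `K` is separably generated, 4.2.10–4.2.11; Mathlib
`exists_isTranscendenceBasis_and_isSeparable_of_perfectField`).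
[cite: SpringerLAG1998, 4.2.9 (ii) with 4.2.10 (cf. proof of 4.2.11)] -/
theorem free_and_finrank_kaehlerDifferential_of_perfectField [PerfectField k]
    [Algebra.EssFiniteType k K] :
    Module.Free K Ω[K⁄k] ∧ (Module.finrank K Ω[K⁄k] : Cardinal) = Algebra.trdeg k K := by
  obtain ⟨s, hs, hsep⟩ := exists_isTranscendenceBasis_and_isSeparable_of_perfectField k K
  have hr : Set.range ((↑) : s → K) = (s : Set K) := Subtype.range_coe
  rw [← hr] at hsep
  obtain ⟨hfree, hfin⟩ := free_and_finrank_kaehlerDifferential_of_isSeparable hs.1 (hsep := hsep)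
  refine ⟨hfree, ?_⟩
  have h := hs.lift_cardinalMk_eq_trdeg
  rw [Cardinal.mk_fintype, Cardinal.lift_natCast, Cardinal.lift_id] at h
  rw [hfin, h]

end SeparablyGenerated

/-! ### Affine domains over a perfect field: generic rank of `Ω_{A/k}` -/

section AffineDomain

variable (k A : Type*) [Field k] [CommRing A] [IsDomain A] [Algebra k A] [Algebra.FiniteType k A]

omit [IsDomain A] in
/-- The function field `k(A) = Frac A` of an affine `k`-algebra is essentially of finite type
over `k`. [folklore] -/
theorem essFiniteType_fractionRing : Algebra.EssFiniteType k (FractionRing A) :=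
  haveI : Algebra.EssFiniteType A (FractionRing A) :=
    Algebra.EssFiniteType.of_isLocalization _ (nonZeroDivisors A)
  Algebra.EssFiniteType.comp k A (FractionRing A)

omit [Algebra.FiniteType k A] in
/-- `trdeg_k Frac(A) = trdeg_k A` for a domain `A` (the fraction field is algebraic over `A`;
Mathlib `trdeg_add_eq`). [folklore] -/
theorem trdeg_fractionRing : Algebra.trdeg k (FractionRing A) = Algebra.trdeg k A := by
  haveI : Algebra.IsAlgebraic A (FractionRing A) :=
    IsLocalization.isAlgebraic _ (nonZeroDivisors A)
  have h := trdeg_add_eq k A (A := FractionRing A)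
  rw [trdeg_eq_zero (R := A) (A := FractionRing A), add_zero] at h
  exact h.symm

/-- **`dim_{k(X)} Ω_{k(X)/k} = dim X`** for an affine domain `A = k[X]` over a perfect field
(Springer 4.3.3, proof, with 4.2.9 (ii), 4.2.10 and `dim A = trdeg`, Matsumura Thm 5.6).
[cite: SpringerLAG1998, 4.3.3 (proof)] -/
theorem free_and_finrank_kaehlerDifferential_fractionRing [PerfectField k] :
    Module.Free (FractionRing A) Ω[FractionRing A⁄k] ∧
      (Module.finrank (FractionRing A) Ω[FractionRing A⁄k] : WithBot ℕ∞) = ringKrullDim A := by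
  haveI := essFiniteType_fractionRing k A
  obtain ⟨hfree, hfin⟩ := free_and_finrank_kaehlerDifferential_of_perfectField (k := k)
    (K := FractionRing A)
  refine ⟨hfree, ?_⟩
  rw [ringKrullDim_eq_trdeg k A, ← trdeg_fractionRing k A, ← hfin, Cardinal.toNat_natCast]

/-- **Generic freeness of `Ω_{A/k}` in rank `dim A`** (Springer 4.3.3 (i)–(ii), in module form):
for an affine domain `A` over a perfect field there is `r ≠ 0` such that `(Ω_{A/k})_r` is a free
`A_r`-module of rank `dim A` (`Ω_{A/k} ⊗ k(A) = Ω_{k(A)/k}` has dimension `dim A`, and a finitely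
presented module free at the generic point is free on a principal open neighbourhood; Mathlib
`Module.FinitePresentation.exists_free_localizedModule_powers`).
[cite: SpringerLAG1998, 4.3.3 (i)–(ii)] -/
theorem exists_free_kaehlerDifferential_away [PerfectField k] :
    ∃ r : A, r ≠ 0 ∧ Module.Free (Localization.Away r) (LocalizedModule.Away r Ω[A⁄k]) ∧
      (Module.finrank (Localization.Away r) (LocalizedModule.Away r Ω[A⁄k]) : WithBot ℕ∞) =
        ringKrullDim A := by
  set K := FractionRing A
  obtain ⟨hfree, hfin⟩ := free_and_finrank_kaehlerDifferential_fractionRing k A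
  haveI := hfree
  haveI : Algebra.FinitePresentation k A := (Algebra.FinitePresentation.of_finiteType).1 ‹_›
  obtain ⟨r, hr, hfree', hrank⟩ :=
    Module.FinitePresentation.exists_free_localizedModule_powers (nonZeroDivisors A)
      (KaehlerDifferential.map k k A K) K
  exact ⟨r, nonZeroDivisors.ne_zero hr, hfree', by rw [hrank, hfin]⟩

end AffineDomain

/-! ### The module `k_x` of a rational point and the tangent space `Der_k(A, k_x)` -/

section PointModule

variable {k A : Type*} [Field k] [CommRing A] [Algebra k A]

/-- The `A`-module `k_x` attached to a `k`-rational point `x` of `Spec A`, i.e. to a `k`-algebra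
homomorphism `φ : A →ₐ[k] k`: the field `k` with `a · c = φ(a) c` (Springer 4.1.2). The tangent
space of `X = Spec A` at `x` is then `Derivation k A (PointModule φ) = Der_k(k[X], k_x)`
(Springer 4.1.3). A type synonym of `k`. [cite: SpringerLAG1998, 4.1.2–4.1.3] -/
@[nolint unusedArguments]
def PointModule (_φ : A →ₐ[k] k) : Type _ := k

namespace PointModule

variable (φ : A →ₐ[k] k)

/-- `k_x` is the additive group of `k`. [folklore] -/
instance : AddCommGroup (PointModule φ) := inferInstanceAs (AddCommGroup k)

/-- `k_x` is `k` as a `k`-vector space. [folklore] -/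
instance : Module k (PointModule φ) := inferInstanceAs (Module k k)

/-- `A` acts on `k_x` through evaluation at the point. [folklore] -/
instance : Module A (PointModule φ) := Module.compHom k (φ : A →+* k)

/-- `k_x` is `k` as a `k`-vector space. [folklore] -/
def toK : PointModule φ ≃ₗ[k] k := LinearEquiv.refl k k

/-- The `A`-action on `k_x` is `a · c = φ(a) c`. [folklore] -/
lemma smul_def (a : A) (c : PointModule φ) : a • c = (φ a • c : PointModule φ) := rfl

/-- The `k`- and `A`-actions on `k_x` are compatible (`φ` is `k`-linear). [folklore] -/
instance : IsScalarTower k A (PointModule φ) :=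
  ⟨fun c a y => by simp only [smul_def, map_smul, smul_assoc]⟩

/-- The `A`- and `k`-actions on `k_x` commute. [folklore] -/
instance : SMulCommClass A k (PointModule φ) :=
  ⟨fun a c y => by simp only [smul_def]; exact smul_comm _ _ _⟩

/-- The `k`- and `A`-actions on `k_x` commute. [folklore] -/
instance : SMulCommClass k A (PointModule φ) :=
  ⟨fun c a y => by simp only [smul_def]; exact smul_comm _ _ _⟩

/-- `k_x` is finite-dimensional over `k`. [folklore] -/
instance : Module.Finite k (PointModule φ) := inferInstanceAs (Module.Finite k k)

/-- `k_x` is free over `k`. [folklore] -/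
instance : Module.Free k (PointModule φ) := inferInstanceAs (Module.Free k k)

/-- `dim_k k_x = 1`. [folklore] -/
lemma finrank_eq : Module.finrank k (PointModule φ) = 1 := Module.finrank_self k

end PointModule

/-- **Tangent spaces are computed by `Ω`** (Springer 4.2.2 (i) applied at a point, as in the
text after 4.3.2, p. 81: `T_x X ≅ Hom(Ω_X(x), k)`; here in the form
`Der_k(A, k_x) ≅ Hom_A(Ω_{A/k}, k_x)`, Mathlib `KaehlerDifferential.linearMapEquivDerivation`), as
a `k`-linear isomorphism. [cite: SpringerLAG1998, 4.2.2 (i), p. 81] -/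
def derivationPointModuleEquiv (φ : A →ₐ[k] k) :
    Derivation k A (PointModule φ) ≃ₗ[k] (Ω[A⁄k] →ₗ[A] PointModule φ) :=
  (KaehlerDifferential.linearMapEquivDerivation k A).symm.restrictScalars k

/-- **Hom out of a generically free `Ω` at a point of the free locus.** If `(Ω_{A/k})_r` is free
of rank `d` over `A_r` and `φ : A → k` is a `k`-point with `φ(r) ≠ 0`, then
`Hom_A(Ω_{A/k}, k_φ)` is `d`-dimensional: `k_φ` is an `A_r`-module, so
`Hom_A(Ω, k_φ) = Hom_{A_r}(Ω_r, k_φ) ≅ k_φ^d` (Springer 4.3.3, proof: "the dimension of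
`T_x X` is `n - s`"). [cite: SpringerLAG1998, 4.3.3 (proof)] -/
theorem finrank_linearMap_pointModule_of_free {r : A}
    [Module.Free (Localization.Away r) (LocalizedModule.Away r Ω[A⁄k])]
    [Module.Finite (Localization.Away r) (LocalizedModule.Away r Ω[A⁄k])]
    (φ : A →ₐ[k] k) (hφ : φ r ≠ 0) :
    Module.Finite k (Ω[A⁄k] →ₗ[A] PointModule φ) ∧
      Module.finrank k (Ω[A⁄k] →ₗ[A] PointModule φ) =
        Module.finrank (Localization.Away r) (LocalizedModule.Away r Ω[A⁄k]) := by
  set Ar := Localization.Away r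
  set M := PointModule φ
  set Ωr := LocalizedModule.Away r Ω[A⁄k]
  -- `k_φ` is an `A_r`-module through `A_r → k`, `a / r^n ↦ φ(a) / φ(r)^n`
  have hu : IsUnit ((φ : A →+* k) r) := isUnit_iff_ne_zero.2 hφ
  let ψ : Ar →+* k := IsLocalization.Away.lift r hu
  have hψ : ∀ a : A, ψ (algebraMap A Ar a) = φ a := fun a => IsLocalization.Away.lift_eq r hu a
  haveI : Nontrivial Ar := ψ.domain_nontrivial
  letI : Module Ar M := Module.compHom k ψ
  have hsmul : ∀ (s : Ar) (y : M), s • y = (ψ s • y : PointModule φ) := fun _ _ => rfl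
  haveI : IsScalarTower A Ar M := ⟨fun a s y => by
    rw [hsmul, Algebra.smul_def, map_mul, hψ, mul_smul, ← PointModule.smul_def, ← hsmul]⟩
  haveI : SMulCommClass Ar k M := ⟨fun s c y => by rw [hsmul, hsmul]; exact smul_comm _ _ _⟩
  haveI : IsScalarTower k Ar M := ⟨fun c s y => by
    rw [hsmul, hsmul, Algebra.smul_def, map_mul, IsScalarTower.algebraMap_apply k A Ar, hψ,
      AlgHom.commutes, mul_smul]
    rfl⟩
  -- `Hom_A(Ω, M) ≅ Hom_{A_r}(A_r ⊗ Ω, M) ≅ Hom_{A_r}(Ω_r, M)`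
  have hB : IsBaseChange Ar (LocalizedModule.mkLinearMap (Submonoid.powers r) Ω[A⁄k]) :=
    IsLocalizedModule.isBaseChange (Submonoid.powers r) Ar _
  let e₁ : (Ω[A⁄k] →ₗ[A] M) ≃ₗ[Ar] (Ar ⊗[A] Ω[A⁄k] →ₗ[Ar] M) := LinearMap.liftBaseChangeEquiv Ar
  let e₂ : (Ar ⊗[A] Ω[A⁄k] →ₗ[Ar] M) ≃ₗ[Ar] (Ωr →ₗ[Ar] M) :=
    LinearEquiv.arrowCongr hB.equiv (LinearEquiv.refl Ar M)
  -- a basis of `Ω_r` identifies `Hom_{A_r}(Ω_r, M)` with `M^ι`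
  let b := Module.Free.chooseBasis Ar Ωr
  letI : Fintype (Module.Free.ChooseBasisIndex Ar Ωr) :=
    Module.Free.ChooseBasisIndex.fintype Ar Ωr
  let e₃ : (Module.Free.ChooseBasisIndex Ar Ωr → M) ≃ₗ[k] (Ωr →ₗ[Ar] M) := b.constr k
  let e : (Ω[A⁄k] →ₗ[A] M) ≃ₗ[k] (Module.Free.ChooseBasisIndex Ar Ωr → M) :=
    ((e₁.restrictScalars k).trans (e₂.restrictScalars k)).trans e₃.symm
  refine ⟨Module.Finite.equiv e.symm, ?_⟩
  rw [e.finrank_eq, Module.finrank_pi_fintype, Finset.sum_const, Finset.card_univ,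
    PointModule.finrank_eq, smul_eq_mul, mul_one, Module.finrank_eq_card_chooseBasisIndex]

variable (k A) in
/-- **Generic simple points of an affine variety over a perfect field** (Springer 4.3.3
(ii)–(iii), 4.1.7): for an affine domain `A` over a perfect field `k`, of dimension `d = dim A`,
there is `r ≠ 0` in `A` such that at every `k`-rational point `x` (`φ : A →ₐ[k] k`) with
`r(x) ≠ 0` the Zariski tangent space `T_x = Der_k(A, k_x)` is finite-dimensional with
`dim_k T_x = d`. (At the other points only `dim T_x ≥ d` holds, 4.3.3 (iii), not proved here.)
[cite: SpringerLAG1998, Thm 4.3.3 (ii)] -/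
theorem exists_finrank_derivation_pointModule_eq [IsDomain A] [Algebra.FiniteType k A]
    [PerfectField k] :
    ∃ r : A, r ≠ 0 ∧ ∀ φ : A →ₐ[k] k, φ r ≠ 0 →
      Module.Finite k (Derivation k A (PointModule φ)) ∧
        (Module.finrank k (Derivation k A (PointModule φ)) : WithBot ℕ∞) = ringKrullDim A := by
  obtain ⟨r, hr, hfree, hrank⟩ := exists_free_kaehlerDifferential_away k A
  haveI := hfree
  haveI : Module.Finite (Localization.Away r) (LocalizedModule.Away r Ω[A⁄k]) :=
    inferInstance
  refine ⟨r, hr, fun φ hφ => ?_⟩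
  obtain ⟨hfin, hdim⟩ := finrank_linearMap_pointModule_of_free φ hφ
  haveI := hfin
  refine ⟨Module.Finite.equiv (derivationPointModuleEquiv φ).symm, ?_⟩
  rw [(derivationPointModuleEquiv φ).finrank_eq, hdim, hrank]

/-! ### Point derivations as linear forms -/

/-- **The tangent space as a space of linear forms** (Springer 4.1.3: `T_x X = Der_k(k[X], k_x)`):
the `k`-linear maps `D : A → k` with `D(ab) = a(x) D(b) + b(x) D(a)`, where `x` is the `k`-point
`φ : A →ₐ[k] k`. This is `Derivation k A (PointModule φ)` (`pointDerivationsEquiv`) presented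
as a subspace of the dual of `A`, the form in which it is computed in coordinates.
[cite: SpringerLAG1998, 4.1.3] -/
def pointDerivations (φ : A →ₐ[k] k) : Submodule k (A →ₗ[k] k) where
  carrier := {D | ∀ a b, D (a * b) = φ a * D b + φ b * D a}
  add_mem' {D₁ D₂} h₁ h₂ a b := by
    simp only [LinearMap.add_apply, h₁ a b, h₂ a b]; ring
  zero_mem' a b := by simp
  smul_mem' c D h a b := by
    simp only [LinearMap.smul_apply, h a b, smul_eq_mul]; ring

/-- Membership in `pointDerivations`: the Leibniz rule at the point. [folklore] -/
lemma mem_pointDerivations_iff {φ : A →ₐ[k] k} {D : A →ₗ[k] k} :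
    D ∈ pointDerivations φ ↔ ∀ a b, D (a * b) = φ a * D b + φ b * D a := Iff.rfl

/-- A point derivation kills `1`. [folklore] -/
lemma pointDerivations.apply_one {φ : A →ₐ[k] k} {D : A →ₗ[k] k} (hD : D ∈ pointDerivations φ) :
    D 1 = 0 := by
  have h : D (1 * 1) = φ 1 * D 1 + φ 1 * D 1 := hD 1 1
  have h1 : φ 1 = 1 := φ.map_one
  rw [mul_one, h1, one_mul] at h
  linear_combination -h

/-- A point derivation kills the constants. [folklore] -/
lemma pointDerivations.apply_algebraMap {φ : A →ₐ[k] k} {D : A →ₗ[k] k}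
    (hD : D ∈ pointDerivations φ) (c : k) : D (algebraMap k A c) = 0 := by
  rw [Algebra.algebraMap_eq_smul_one, map_smul, pointDerivations.apply_one hD, smul_zero]

/-- `pointDerivations φ` **is** `Der_k(A, k_φ)` (the same functions; Springer 4.1.3).
[cite: SpringerLAG1998, 4.1.3] -/
def pointDerivationsEquiv (φ : A →ₐ[k] k) :
    pointDerivations φ ≃ₗ[k] Derivation k A (PointModule φ) where
  toFun D :=
    { toLinearMap := (PointModule.toK φ).symm.toLinearMap ∘ₗ D.1
      map_one_eq_zero' := by
        change D.1 1 = (0 : k)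
        exact pointDerivations.apply_one D.2
      leibniz' := fun a b => by
        change D.1 (a * b) = φ a * D.1 b + φ b * D.1 a
        exact D.2 a b }
  invFun D := ⟨(PointModule.toK φ).toLinearMap ∘ₗ D.toLinearMap, fun a b => by
    change D (a * b) = φ a • D b + φ b • D a
    exact D.leibniz a b⟩
  map_add' _ _ := Derivation.ext fun _ => rfl
  map_smul' _ _ := Derivation.ext fun _ => rfl
  left_inv _ := rfl
  right_inv _ := rfl

/-- `pointDerivationsEquiv` does not change the underlying function. [folklore] -/
@[simp] lemma pointDerivationsEquiv_apply (φ : A →ₐ[k] k) (D : pointDerivations φ) (a : A) :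
    PointModule.toK φ (pointDerivationsEquiv φ D a) = D.1 a := rfl

/-- `pointDerivationsEquiv.symm` does not change the underlying function. [folklore] -/
@[simp] lemma pointDerivationsEquiv_symm_apply (φ : A →ₐ[k] k)
    (D : Derivation k A (PointModule φ)) (a : A) :
    ((pointDerivationsEquiv φ).symm D).1 a = PointModule.toK φ (D a) := rfl

variable (k A) in
/-- **Generic simple points, linear-form version** of `exists_finrank_derivation_pointModule_eq`:
for an affine domain `A` over a perfect field there is `r ≠ 0` such that
`dim_k pointDerivations φ = dim A` at every `k`-point `φ` with `φ r ≠ 0`.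
[cite: SpringerLAG1998, Thm 4.3.3 (ii)] -/
theorem exists_finrank_pointDerivations_eq [IsDomain A] [Algebra.FiniteType k A]
    [PerfectField k] :
    ∃ r : A, r ≠ 0 ∧ ∀ φ : A →ₐ[k] k, φ r ≠ 0 →
      Module.Finite k (pointDerivations φ) ∧
        (Module.finrank k (pointDerivations φ) : WithBot ℕ∞) = ringKrullDim A := by
  obtain ⟨r, hr, h⟩ := exists_finrank_derivation_pointModule_eq k A
  refine ⟨r, hr, fun φ hφ => ?_⟩
  obtain ⟨hfin, hdim⟩ := h φ hφ
  haveI := hfin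
  exact ⟨Module.Finite.equiv (pointDerivationsEquiv φ).symm,
    by rw [(pointDerivationsEquiv φ).finrank_eq, hdim]⟩

end PointModule

open MvPolynomial


/-! ### Differentials of morphisms: precomposition of point derivations -/

section Precomp

variable {k A B : Type*} [Field k] [CommRing A] [CommRing B] [Algebra k A] [Algebra k B]

/-- **The differential of a morphism at a point** (Springer 4.1.3): for a `k`-algebra
homomorphism `f : B → A` (the comorphism of `X → Y`) and a `k`-point `φ` of `A`, precomposition
with `f` maps `Der_k(A, k_φ)` to `Der_k(B, k_{φ ∘ f})`, `k`-linearly. [cite: SpringerLAG1998, 4.1.3] -/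
def pointDerivations.precomp (f : B →ₐ[k] A) (φ : A →ₐ[k] k) :
    pointDerivations φ →ₗ[k] pointDerivations (φ.comp f) where
  toFun D := ⟨D.1 ∘ₗ f.toLinearMap, fun a b => by
    simp only [LinearMap.coe_comp, Function.comp_apply, AlgHom.toLinearMap_apply, map_mul,
      AlgHom.coe_comp]
    exact D.2 (f a) (f b)⟩
  map_add' _ _ := rfl
  map_smul' _ _ := rfl

/-- Unfolding `precomp`. [folklore] -/
@[simp] lemma pointDerivations.precomp_apply (f : B →ₐ[k] A) (φ : A →ₐ[k] k)
    (D : pointDerivations φ) (b : B) :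
    (pointDerivations.precomp f φ D).1 b = D.1 (f b) := rfl

/-- The differential of a closed immersion (surjective comorphism) is injective. [folklore] -/
theorem pointDerivations.precomp_injective {f : B →ₐ[k] A} (hf : Function.Surjective f)
    (φ : A →ₐ[k] k) : Function.Injective (pointDerivations.precomp f φ) := by
  intro D₁ D₂ h
  refine Subtype.ext (LinearMap.ext fun a => ?_)
  obtain ⟨b, rfl⟩ := hf a
  have := congrArg (fun D : pointDerivations (φ.comp f) => D.1 b) h
  simpa using this

/-- A linear form on `B` vanishing on the ideal `I` descends to `B ⧸ I`. [folklore] -/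
def descendLinearForm (I : Ideal B) (D : B →ₗ[k] k) (h : ∀ b ∈ I, D b = 0) : (B ⧸ I) →ₗ[k] k :=
  (Submodule.liftQ (I.restrictScalars k) D fun b hb => by
      rw [LinearMap.mem_ker]; exact h b hb) ∘ₗ
    (Submodule.Quotient.restrictScalarsEquiv k I).symm.toLinearMap

/-- The descended form on representatives. [folklore] -/
@[simp] lemma descendLinearForm_mk (I : Ideal B) (D : B →ₗ[k] k) (h : ∀ b ∈ I, D b = 0)
    (b : B) : descendLinearForm I D h (Ideal.Quotient.mk I b) = D b := by
  rw [descendLinearForm, LinearMap.comp_apply, LinearEquiv.coe_coe, ← Ideal.Quotient.mk_eq_mk,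
    Submodule.Quotient.restrictScalarsEquiv_symm_mk, Submodule.liftQ_apply]

end Precomp

/-! ### Coordinates: the tangent space of `V(I) ⊆ kⁿ` at a point -/

section Coordinates

variable {k : Type*} [Field k] {σ : Type*} [Fintype σ]

omit [Fintype σ] in
/-- `aeval a p = eval a p` for a `k`-valued point `a` (Mathlib's `coe_aeval_eq_eval`, applied).
[folklore] -/
lemma aeval_apply_eq_eval (a : σ → k) (p : MvPolynomial σ k) : aeval a p = eval a p := by
  rw [← coe_aeval_eq_eval]; rfl

/-- **The tangent space in coordinates** (Springer 4.1.2): for an ideal `I ⊆ k[T_i]_{i ∈ σ}` and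
a point `a ∈ k^σ`, the subspace of `k^σ` of vectors `v` with `∑ᵢ (∂f/∂Tᵢ)(a) · vᵢ = 0` for all
`f ∈ I` (the lines through `a` "tangent" to `V(I)`; meaningful when `a` is a zero of `I`).
[cite: SpringerLAG1998, 4.1.2] -/
def tangentSpaceAt (I : Ideal (MvPolynomial σ k)) (a : σ → k) : Submodule k (σ → k) where
  carrier := {v | ∀ f ∈ I, ∑ i, eval a (pderiv i f) * v i = 0}
  add_mem' {v w} hv hw f hf := by
    have := congrArg₂ (· + ·) (hv f hf) (hw f hf)
    simpa [mul_add, Finset.sum_add_distrib] using this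
  zero_mem' f hf := by simp
  smul_mem' c v hv f hf := by
    have := congrArg (c * ·) (hv f hf)
    simpa [Finset.mul_sum, mul_left_comm] using this

/-- Membership in `tangentSpaceAt`. [folklore] -/
lemma mem_tangentSpaceAt_iff {I : Ideal (MvPolynomial σ k)} {a v : σ → k} :
    v ∈ tangentSpaceAt I a ↔ ∀ f ∈ I, ∑ i, eval a (pderiv i f) * v i = 0 := Iff.rfl

/-- **Point derivations of the polynomial ring in coordinates** (Springer 4.1.2, the formula
`D_x f = ∑ᵢ vᵢ (∂f/∂Tᵢ)(x)`): a point derivation `D` of `k[T]` at `a` is determined by its values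
on the variables through `D f = ∑ᵢ (∂f/∂Tᵢ)(a) · D(Tᵢ)`. [cite: SpringerLAG1998, 4.1.2] -/
theorem pointDerivations.apply_eq_sum_pderiv (a : σ → k) {D : MvPolynomial σ k →ₗ[k] k}
    (hD : D ∈ pointDerivations (aeval a)) (f : MvPolynomial σ k) :
    D f = ∑ i, eval a (pderiv i f) * D (X i) := by
  classical
  induction f using MvPolynomial.induction_on with
  | C c =>
    rw [← MvPolynomial.algebraMap_eq, pointDerivations.apply_algebraMap hD]
    simp [MvPolynomial.algebraMap_eq]
  | add f g hf hg =>
    simp only [map_add, hf, hg, add_mul, Finset.sum_add_distrib]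
  | mul_X f i hf =>
    rw [hD f (X i), aeval_apply_eq_eval, aeval_apply_eq_eval, eval_X, hf]
    have h1 : ∀ j, eval a (pderiv j (f * X i)) * D (X j) =
        eval a f * (eval a (pderiv j (X i)) * D (X j)) +
          a i * (eval a (pderiv j f) * D (X j)) := by
      intro j
      rw [Derivation.leibniz, smul_eq_mul, smul_eq_mul, map_add, map_mul, map_mul, eval_X]
      ring
    simp only [h1, Finset.sum_add_distrib, ← Finset.mul_sum]
    congr 1
    rw [Finset.sum_eq_single i, pderiv_X_self, map_one, one_mul]
    · intro j _ hji; rw [pderiv_X_of_ne (Ne.symm hji), map_zero, zero_mul]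
    · intro h; exact absurd (Finset.mem_univ i) h

/-- The linear form `f ↦ ∑ᵢ (∂f/∂Tᵢ)(a) vᵢ` on `k[T]` attached to a vector `v ∈ k^σ`: the point
derivation at `a` with values `vᵢ` on the variables (Springer 4.1.2, `D_x`). [cite: SpringerLAG1998, 4.1.2] -/
def linearFormOfVector (a v : σ → k) : MvPolynomial σ k →ₗ[k] k :=
  ∑ i, v i • ((MvPolynomial.aeval a : MvPolynomial σ k →ₐ[k] k).toLinearMap ∘ₗ
    ((pderiv i : Derivation k (MvPolynomial σ k) (MvPolynomial σ k)) :
      MvPolynomial σ k →ₗ[k] MvPolynomial σ k))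

/-- `linearFormOfVector a v f = ∑ᵢ (∂f/∂Tᵢ)(a) vᵢ`. [folklore] -/
@[simp] lemma linearFormOfVector_apply (a v : σ → k) (f : MvPolynomial σ k) :
    linearFormOfVector a v f = ∑ i, eval a (pderiv i f) * v i := by
  simp only [linearFormOfVector, LinearMap.coe_sum, Finset.sum_apply, LinearMap.smul_apply,
    LinearMap.coe_comp, Function.comp_apply, AlgHom.toLinearMap_apply, aeval_apply_eq_eval,
    smul_eq_mul]
  refine Finset.sum_congr rfl fun i _ => ?_
  rw [mul_comm]
  rfl

/-- `linearFormOfVector a v` is a point derivation at `a`. [folklore] -/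
lemma linearFormOfVector_mem (a v : σ → k) : linearFormOfVector a v ∈ pointDerivations (aeval a) := by
  intro f g
  rw [aeval_apply_eq_eval, aeval_apply_eq_eval, linearFormOfVector_apply, linearFormOfVector_apply,
    linearFormOfVector_apply]
  simp only [Derivation.leibniz, smul_eq_mul, map_add, map_mul, add_mul, Finset.sum_add_distrib,
    Finset.mul_sum]
  congr 1 <;> exact Finset.sum_congr rfl fun i _ => by ring

/-- `linearFormOfVector a v (Tᵢ) = vᵢ`. [folklore] -/
@[simp] lemma linearFormOfVector_X (a v : σ → k) (i : σ) : linearFormOfVector a v (X i) = v i := by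
  classical
  rw [linearFormOfVector_apply, Finset.sum_eq_single i]
  · simp
  · intro j _ hji; simp [pderiv_X, Ne.symm hji]
  · intro h; exact absurd (Finset.mem_univ i) h

/-! ### Dual numbers compute the differential (Springer 4.1.2, 4.1.9 (3)) -/

section DualNumbers

open TrivSqZeroExt DualNumber

/-- The `k[ε]`-valued point `a + ε v` of affine space (Springer 4.1.9 (3)). [folklore] -/
def dualNumberPoint (a v : σ → k) : σ → k[ε] := fun i => inl (a i) + inr (v i)

omit [Fintype σ] in
/-- `fst (a + ε v)ᵢ = aᵢ`. [folklore] -/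
@[simp] lemma fst_dualNumberPoint (a v : σ → k) (i : σ) : fst (dualNumberPoint a v i) = a i := by
  simp [dualNumberPoint]

omit [Fintype σ] in
/-- `snd (a + ε v)ᵢ = vᵢ`. [folklore] -/
@[simp] lemma snd_dualNumberPoint (a v : σ → k) (i : σ) : snd (dualNumberPoint a v i) = v i := by
  simp [dualNumberPoint]

omit [Fintype σ] in
/-- The `k`-part of `p (a + ε v)` is `p (a)`. [folklore] -/
lemma fst_aeval_dualNumberPoint (a v : σ → k) (p : MvPolynomial σ k) :
    fst (aeval (dualNumberPoint a v) p) = eval a p := by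
  have h := MvPolynomial.map_aeval (dualNumberPoint a v) (TrivSqZeroExt.fstHom k k k).toRingHom p
  simp only [AlgHom.toRingHom_eq_coe, RingHom.coe_coe, fstHom_apply] at h
  have hc : ((TrivSqZeroExt.fstHom k k k : k[ε] →ₐ[k] k) : k[ε] →+* k).comp (algebraMap k k[ε]) =
      RingHom.id k :=
    RingHom.ext fun c => by simp
  have hf : (fun i => fst (dualNumberPoint a v i)) = a := funext (fst_dualNumberPoint a v)
  rw [h, hc, hf]
  rfl

/-- **Dual numbers compute the differential** (Springer 4.1.2: "`p(x + t v) ≡ p(x) +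
t ∑ᵢ vᵢ (∂p/∂Tᵢ)(x) mod t²`", 4.1.9 (3)): the `ε`-part of `p (a + ε v) ∈ k[ε]` is
`∑ᵢ (∂p/∂Tᵢ)(a) vᵢ`. [cite: SpringerLAG1998, 4.1.2 and 4.1.9 (3)] -/
theorem snd_aeval_dualNumberPoint (a v : σ → k) (p : MvPolynomial σ k) :
    snd (aeval (dualNumberPoint a v) p) = linearFormOfVector a v p := by
  -- `p ↦ snd (p (a + ε v))` is a point derivation at `a` with values `vᵢ` on the variables
  let D : MvPolynomial σ k →ₗ[k] k :=
    (TrivSqZeroExt.sndHom k k).comp (aeval (dualNumberPoint a v) : MvPolynomial σ k →ₐ[k] k[ε]).toLinearMap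
  have hD : D ∈ pointDerivations (aeval a) := fun p q => by
    simp only [D, LinearMap.coe_comp, Function.comp_apply, AlgHom.toLinearMap_apply, map_mul,
      TrivSqZeroExt.sndHom_apply, DualNumber.snd_mul, fst_aeval_dualNumberPoint,
      aeval_apply_eq_eval]
    ring
  have h := pointDerivations.apply_eq_sum_pderiv a hD p
  simp only [D, LinearMap.coe_comp, Function.comp_apply, AlgHom.toLinearMap_apply,
    TrivSqZeroExt.sndHom_apply, aeval_X, snd_dualNumberPoint] at h
  rw [linearFormOfVector_apply]
  exact h

/-- `p (a + ε v) = p(a) + ε · (∑ᵢ (∂p/∂Tᵢ)(a) vᵢ)` in `k[ε]` (Springer 4.1.2). [cite: SpringerLAG1998, 4.1.2] -/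
theorem aeval_dualNumberPoint (a v : σ → k) (p : MvPolynomial σ k) :
    aeval (dualNumberPoint a v) p = inl (eval a p) + inr (linearFormOfVector a v p) :=
  TrivSqZeroExt.ext (by simp [fst_aeval_dualNumberPoint]) (by simp [snd_aeval_dualNumberPoint])

end DualNumbers

variable (I : Ideal (MvPolynomial σ k)) (a : σ → k)

/-- The `k`-point of `k[T]/I` defined by a zero `a` of `I` (evaluation at `a`). [folklore] -/
def pointOfZero (ha : ∀ f ∈ I, eval a f = 0) : (MvPolynomial σ k ⧸ I) →ₐ[k] k :=
  Ideal.Quotient.liftₐ I (aeval a) (fun f hf => by rw [aeval_apply_eq_eval]; exact ha f hf)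

omit [Fintype σ] in
/-- `pointOfZero` evaluates representatives at `a`. [folklore] -/
@[simp] lemma pointOfZero_mk (ha : ∀ f ∈ I, eval a f = 0) (f : MvPolynomial σ k) :
    pointOfZero I a ha (Ideal.Quotient.mk I f) = eval a f := by
  change Ideal.Quotient.lift I ((aeval a : MvPolynomial σ k →ₐ[k] k) : MvPolynomial σ k →+* k) _
    (Ideal.Quotient.mk I f) = _
  rw [Ideal.Quotient.lift_mk, RingHom.coe_coe, aeval_apply_eq_eval]

omit [Fintype σ] in
/-- `pointOfZero ∘ mk = aeval a`. [folklore] -/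
lemma pointOfZero_comp_mkₐ (ha : ∀ f ∈ I, eval a f = 0) :
    (pointOfZero I a ha).comp (Ideal.Quotient.mkₐ k I) = aeval a :=
  AlgHom.ext fun f => by
    rw [AlgHom.comp_apply, Ideal.Quotient.mkₐ_eq_mk, pointOfZero_mk, aeval_apply_eq_eval]

omit [Fintype σ] in
/-- Pulling a point derivation of `k[T]/I` back to `k[T]` gives a point derivation at `a`
(Springer 4.1.2). [folklore] -/
lemma comp_mk_mem_pointDerivations (ha : ∀ f ∈ I, eval a f = 0)
    (D : pointDerivations (pointOfZero I a ha)) :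
    D.1 ∘ₗ (Ideal.Quotient.mkₐ k I).toLinearMap ∈ pointDerivations (aeval a) := by
  rw [← pointOfZero_comp_mkₐ I a ha]
  exact (pointDerivations.precomp (Ideal.Quotient.mkₐ k I) (pointOfZero I a ha) D).2

/-- The linear form of a tangent vector `v ∈ tangentSpaceAt I a` vanishes on `I`. [folklore] -/
lemma linearFormOfVector_eq_zero (v : tangentSpaceAt I a) (f : MvPolynomial σ k) (hf : f ∈ I) :
    linearFormOfVector a v f = 0 := by
  rw [linearFormOfVector_apply]; exact v.2 f hf

/-- **`tangentSpaceAt I a` is the tangent space `Der_k(k[T]/I, k_a)`** of the closed subvariety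
`V(I)` at its point `a` (Springer 4.1.2–4.1.3: a derivation of `k[T]/I` at `a` is a derivation
of `k[T]` at `a` vanishing on `I`, i.e. a vector `v` with `∑ᵢ (∂f/∂Tᵢ)(a) vᵢ = 0` for
`f ∈ I`; the map is `D ↦ (D(Tᵢ))ᵢ`). [cite: SpringerLAG1998, 4.1.2–4.1.3] -/
def tangentSpaceAtEquiv (ha : ∀ f ∈ I, eval a f = 0) :
    pointDerivations (pointOfZero I a ha) ≃ₗ[k] tangentSpaceAt I a where
  toFun D := ⟨fun i => D.1 (Ideal.Quotient.mk I (X i)), fun f hf => by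
    have h := pointDerivations.apply_eq_sum_pderiv a (comp_mk_mem_pointDerivations I a ha D) f
    simp only [LinearMap.coe_comp, Function.comp_apply, AlgHom.toLinearMap_apply,
      Ideal.Quotient.mkₐ_eq_mk, Ideal.Quotient.eq_zero_iff_mem.2 hf, map_zero] at h
    exact h.symm⟩
  invFun v := ⟨descendLinearForm I (linearFormOfVector a v) (linearFormOfVector_eq_zero I a v), by
    rintro ⟨f⟩ ⟨g⟩
    change descendLinearForm I (linearFormOfVector a v) (linearFormOfVector_eq_zero I a v)
        (Ideal.Quotient.mk I (f * g)) =
      pointOfZero I a ha (Ideal.Quotient.mk I f) *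
        descendLinearForm I (linearFormOfVector a v) (linearFormOfVector_eq_zero I a v)
          (Ideal.Quotient.mk I g) +
      pointOfZero I a ha (Ideal.Quotient.mk I g) *
        descendLinearForm I (linearFormOfVector a v) (linearFormOfVector_eq_zero I a v)
          (Ideal.Quotient.mk I f)
    rw [descendLinearForm_mk, descendLinearForm_mk, descendLinearForm_mk, pointOfZero_mk,
      pointOfZero_mk]
    have := linearFormOfVector_mem a v f g
    rwa [aeval_apply_eq_eval, aeval_apply_eq_eval] at this⟩
  map_add' _ _ := rfl
  map_smul' _ _ := rfl
  left_inv D := by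
    refine Subtype.ext (LinearMap.ext fun x => ?_)
    obtain ⟨f, rfl⟩ := Ideal.Quotient.mk_surjective x
    simp only [descendLinearForm_mk, linearFormOfVector_apply]
    have h := pointDerivations.apply_eq_sum_pderiv a (comp_mk_mem_pointDerivations I a ha D) f
    simpa using h.symm
  right_inv v := by
    refine Subtype.ext (funext fun i => ?_)
    change descendLinearForm I (linearFormOfVector a v) (linearFormOfVector_eq_zero I a v)
      (Ideal.Quotient.mk I (X i)) = v.1 i
    rw [descendLinearForm_mk, linearFormOfVector_X]

/-- `tangentSpaceAtEquiv D i = D (Tᵢ mod I)`. [folklore] -/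
@[simp] lemma tangentSpaceAtEquiv_apply (ha : ∀ f ∈ I, eval a f = 0)
    (D : pointDerivations (pointOfZero I a ha)) (i : σ) :
    (tangentSpaceAtEquiv I a ha D).1 i = D.1 (Ideal.Quotient.mk I (X i)) := rfl

/-- **Springer 4.3.3 (ii) in coordinates: generic points of an irreducible closed subvariety of
affine space are simple.** If `I ⊆ k[T_i]_{i ∈ σ}` (`σ` finite) is prime and `k` is perfect,
there is a polynomial `f ∉ I` such that at every zero `a` of `I` with `f(a) ≠ 0` the tangent
space `tangentSpaceAt I a` has dimension `dim k[T]/I`. [cite: SpringerLAG1998, Thm 4.3.3 (ii)] -/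
theorem exists_finrank_tangentSpaceAt_eq [PerfectField k] [I.IsPrime] :
    ∃ f ∉ I, ∀ a : σ → k, (ha : ∀ g ∈ I, eval a g = 0) → eval a f ≠ 0 →
      Module.Finite k (tangentSpaceAt I a) ∧
        (Module.finrank k (tangentSpaceAt I a) : WithBot ℕ∞) =
          ringKrullDim (MvPolynomial σ k ⧸ I) := by
  haveI : IsDomain (MvPolynomial σ k ⧸ I) := Ideal.Quotient.isDomain I
  obtain ⟨r, hr, h⟩ := exists_finrank_pointDerivations_eq k (MvPolynomial σ k ⧸ I)
  obtain ⟨f, rfl⟩ := Ideal.Quotient.mk_surjective r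
  refine ⟨f, fun hf => hr (Ideal.Quotient.eq_zero_iff_mem.2 hf), fun a ha hfa => ?_⟩
  obtain ⟨hfin, hdim⟩ := h (pointOfZero I a ha) (by rwa [pointOfZero_mk])
  haveI := hfin
  let e := tangentSpaceAtEquiv I a ha
  exact ⟨Module.Finite.equiv e, by rw [← e.finrank_eq, hdim]⟩

end Coordinates

/-! ### `dim_x X ≤ dim T_x X`: the height of a rational point is at most the tangent dimension -/

section EmbeddingDimension

variable {k B : Type*} [Field k] [CommRing B] [Algebra k B] (φ : B →ₐ[k] k)

/-- The maximal ideal `𝔪_x = Ker φ` of the `k`-rational point `x = φ` (Springer 4.1.3: "the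
maximal ideal of functions vanishing in `x`"). [folklore] -/
abbrev pointIdeal : Ideal B := RingHom.ker (φ : B →+* k)

/-- Membership in `𝔪_x`: vanishing at the point. [folklore] -/
lemma mem_pointIdeal_iff {b : B} : b ∈ pointIdeal φ ↔ φ b = 0 := RingHom.mem_ker

/-- `f - f(x) ∈ 𝔪_x`. [folklore] -/
lemma sub_algebraMap_mem_pointIdeal (b : B) : b - algebraMap k B (φ b) ∈ pointIdeal φ := by
  rw [mem_pointIdeal_iff, map_sub, AlgHom.commutes, Algebra.algebraMap_self, RingHom.id_apply,
    sub_self]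

/-- `𝔪_x` is a maximal ideal (`B/𝔪_x = k`). [folklore] -/
lemma isMaximal_pointIdeal : (pointIdeal φ).IsMaximal :=
  RingHom.ker_isMaximal_of_surjective (φ : B →+* k) fun c => ⟨algebraMap k B c, φ.commutes c⟩

/-- A point derivation restricted to `𝔪_x`, as a `k`-linear map killing `𝔪_x²`. [folklore] -/
def pointDerivations.restrictIdeal (D : pointDerivations φ) : ↥(pointIdeal φ) →ₗ[k] k :=
  D.1 ∘ₗ ((pointIdeal φ).subtype.restrictScalars k)

/-- Point derivations kill products of elements of `𝔪_x`. [folklore] -/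
lemma pointDerivations.restrictIdeal_mul (D : pointDerivations φ) (x y : ↥(pointIdeal φ)) :
    pointDerivations.restrictIdeal φ D (x * y) = 0 := by
  change D.1 ((x : B) * y) = 0
  rw [D.2, (mem_pointIdeal_iff φ).1 x.2, (mem_pointIdeal_iff φ).1 y.2, zero_mul, zero_mul,
    add_zero]

/-- **Springer 4.1.4, the map `λ`**: a point derivation `D` at `x` defines the linear form
`f + 𝔪_x² ↦ D f` on `𝔪_x/𝔪_x²`. [cite: SpringerLAG1998, 4.1.4] -/
def pointDerivations.toCotangentDual :
    pointDerivations φ →ₗ[k] Module.Dual k (pointIdeal φ).Cotangent where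
  toFun D := Ideal.Cotangent.lift (pointDerivations.restrictIdeal φ D)
    (pointDerivations.restrictIdeal_mul φ D)
  map_add' D₁ D₂ := by
    refine LinearMap.ext fun c => ?_
    obtain ⟨x, rfl⟩ := (pointIdeal φ).toCotangent_surjective c
    simp [pointDerivations.restrictIdeal]
  map_smul' a D := by
    refine LinearMap.ext fun c => ?_
    obtain ⟨x, rfl⟩ := (pointIdeal φ).toCotangent_surjective c
    simp [pointDerivations.restrictIdeal]

/-- `λ(D) (f + 𝔪²) = D f`. [folklore] -/
@[simp] lemma pointDerivations.toCotangentDual_toCotangent (D : pointDerivations φ)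
    (x : ↥(pointIdeal φ)) :
    pointDerivations.toCotangentDual φ D ((pointIdeal φ).toCotangent x) = D.1 x := rfl

/-- `f ↦ f - f(x)`, as a `k`-linear map `B → 𝔪_x`. [folklore] -/
def toPointIdeal : B →ₗ[k] ↥(pointIdeal φ) :=
  LinearMap.codRestrict ((pointIdeal φ).restrictScalars k)
    (LinearMap.id - (Algebra.linearMap k B) ∘ₗ φ.toLinearMap) (sub_algebraMap_mem_pointIdeal φ)

/-- Unfolding `toPointIdeal`. [folklore] -/
@[simp] lemma coe_toPointIdeal (b : B) : (toPointIdeal φ b : B) = b - algebraMap k B (φ b) := rfl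

/-- **Springer 4.1.4, the map `μ`**: a linear form `l` on `𝔪_x/𝔪_x²` defines the point
derivation `μ(l) f = l (f - f(x) + 𝔪_x²)`. [cite: SpringerLAG1998, 4.1.4] -/
def pointDerivations.ofCotangentDual (l : Module.Dual k (pointIdeal φ).Cotangent) :
    pointDerivations φ :=
  ⟨l ∘ₗ ((pointIdeal φ).toCotangent.restrictScalars k) ∘ₗ toPointIdeal φ, fun a b => by
    have h : ((toPointIdeal φ (a * b) : ↥(pointIdeal φ)) : B) -
        ((φ a • toPointIdeal φ b + φ b • toPointIdeal φ a : ↥(pointIdeal φ)) : B) =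
        (a - algebraMap k B (φ a)) * (b - algebraMap k B (φ b)) := by
      simp only [Submodule.coe_add, Submodule.coe_smul_of_tower, coe_toPointIdeal, map_mul,
        Algebra.smul_def]
      ring
    have key : (pointIdeal φ).toCotangent (toPointIdeal φ (a * b)) =
        (pointIdeal φ).toCotangent (φ a • toPointIdeal φ b + φ b • toPointIdeal φ a) := by
      rw [Ideal.toCotangent_eq, pow_two, h]
      exact Ideal.mul_mem_mul (sub_algebraMap_mem_pointIdeal φ a)
        (sub_algebraMap_mem_pointIdeal φ b)
    change l ((pointIdeal φ).toCotangent (toPointIdeal φ (a * b))) =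
      φ a * l ((pointIdeal φ).toCotangent (toPointIdeal φ b)) +
        φ b * l ((pointIdeal φ).toCotangent (toPointIdeal φ a))
    rw [key, map_add, LinearMap.map_smul_of_tower, LinearMap.map_smul_of_tower, map_add,
      map_smul, map_smul, smul_eq_mul, smul_eq_mul]⟩

/-- `μ(l) f = l (f - f(x) + 𝔪²)`. [folklore] -/
@[simp] lemma pointDerivations.ofCotangentDual_apply (l : Module.Dual k (pointIdeal φ).Cotangent)
    (b : B) :
    (pointDerivations.ofCotangentDual φ l).1 b = l ((pointIdeal φ).toCotangent (toPointIdeal φ b)) :=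
  rfl

/-- **Springer 4.1.4: `λ` is an isomorphism of `T_x X = Der_k(B, k_x)` onto the dual of
`𝔪_x/𝔪_x²`**, with inverse `μ`. [cite: SpringerLAG1998, Lemma 4.1.4] -/
def pointDerivationsEquivCotangentDual :
    pointDerivations φ ≃ₗ[k] Module.Dual k (pointIdeal φ).Cotangent where
  toLinearMap := pointDerivations.toCotangentDual φ
  invFun := pointDerivations.ofCotangentDual φ
  left_inv D := by
    refine Subtype.ext (LinearMap.ext fun b => ?_)
    change (pointDerivations.ofCotangentDual φ (pointDerivations.toCotangentDual φ D)).1 b = D.1 b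
    rw [pointDerivations.ofCotangentDual_apply, pointDerivations.toCotangentDual_toCotangent,
      coe_toPointIdeal, map_sub, pointDerivations.apply_algebraMap D.2, sub_zero]
  right_inv l := by
    refine LinearMap.ext fun c => ?_
    obtain ⟨x, rfl⟩ := (pointIdeal φ).toCotangent_surjective c
    change pointDerivations.toCotangentDual φ (pointDerivations.ofCotangentDual φ l)
      ((pointIdeal φ).toCotangent x) = l ((pointIdeal φ).toCotangent x)
    rw [pointDerivations.toCotangentDual_toCotangent, pointDerivations.ofCotangentDual_apply]
    congr 2
    refine Subtype.ext ?_
    rw [coe_toPointIdeal, (mem_pointIdeal_iff φ).1 x.2, map_zero, sub_zero]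

/-- `B` acts on `𝔪_x/𝔪_x²` through the point: `b · c = b(x) c`. [folklore] -/
lemma smul_cotangent_eq (b : B) (c : (pointIdeal φ).Cotangent) : b • c = φ b • c := by
  have h : b = algebraMap k B (φ b) + (b - algebraMap k B (φ b)) := by ring
  conv_lhs => rw [h, add_smul]
  rw [Ideal.Cotangent.smul_eq_zero_of_mem (sub_algebraMap_mem_pointIdeal φ b), add_zero,
    algebraMap_smul]

/-- For Noetherian `B`, the cotangent space `𝔪_x/𝔪_x²` of a rational point is
finite-dimensional over `k`. [folklore] -/
theorem finite_cotangent_pointIdeal [IsNoetherianRing B] :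
    Module.Finite k (pointIdeal φ).Cotangent := by
  have hfin : Module.Finite B (pointIdeal φ).Cotangent :=
    Module.Finite.of_surjective (pointIdeal φ).toCotangent (pointIdeal φ).toCotangent_surjective
  obtain ⟨s, hs⟩ := hfin
  refine ⟨⟨s, top_le_iff.1 fun c hc0 => ?_⟩⟩
  have hc : c ∈ Submodule.span B (s : Set (pointIdeal φ).Cotangent) := hs ▸ Submodule.mem_top
  clear hs hc0
  induction hc using Submodule.span_induction with
  | mem x hx => exact Submodule.subset_span hx
  | zero => exact zero_mem _
  | add x y _ _ hx hy => exact add_mem hx hy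
  | smul b x _ hx => rw [smul_cotangent_eq]; exact Submodule.smul_mem _ _ hx

/-- For Noetherian `B`, the tangent space `Der_k(B, k_x)` at a rational point is
finite-dimensional (it is dual to `𝔪_x/𝔪_x²`, 4.1.4). [folklore] -/
theorem finite_pointDerivations [IsNoetherianRing B] : Module.Finite k (pointDerivations φ) := by
  haveI := finite_cotangent_pointIdeal φ
  exact Module.Finite.equiv (pointDerivationsEquivCotangentDual φ).symm

/-- **`dim T_x = dim 𝔪_x/𝔪_x²`** (Springer 4.1.4) for Noetherian `B`. [cite: SpringerLAG1998, Lemma 4.1.4] -/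
theorem finrank_pointDerivations_eq_finrank_cotangent [IsNoetherianRing B] :
    Module.finrank k (pointDerivations φ) = Module.finrank k (pointIdeal φ).Cotangent := by
  haveI := finite_cotangent_pointIdeal φ
  rw [(pointDerivationsEquivCotangentDual φ).finrank_eq, Subspace.dual_finrank_eq]

/-- `𝔪_x ⊆ (lifts of generators of 𝔪_x/𝔪_x²) + 𝔪_x²`. [folklore] -/
lemma pointIdeal_le_span_sup_sq {ι : Type*} (g : ι → ↥(pointIdeal φ))
    (hg : Submodule.span k (Set.range fun i => (pointIdeal φ).toCotangent (g i)) = ⊤) :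
    pointIdeal φ ≤ Ideal.span (Set.range fun i => (g i : B)) ⊔ pointIdeal φ ^ 2 := by
  intro x hx
  have hmem : (pointIdeal φ).toCotangent ⟨x, hx⟩ ∈
      Submodule.span k (Set.range fun i => (pointIdeal φ).toCotangent (g i)) := by
    rw [hg]; exact Submodule.mem_top
  obtain ⟨c, hc⟩ := (Finsupp.mem_span_range_iff_exists_finsupp).1 hmem
  -- `y = ∑ cᵢ gᵢ ∈ 𝔪_x` has the same class as `x`
  set y : ↥(pointIdeal φ) := c.sum fun i a => a • g i with hy
  have hty : (pointIdeal φ).toCotangent y = (pointIdeal φ).toCotangent ⟨x, hx⟩ := by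
    rw [← hc, hy, map_finsuppSum]
    simp only [LinearMap.map_smul_of_tower]
  have hxy : x - (y : B) ∈ pointIdeal φ ^ 2 := (Ideal.toCotangent_eq _).1 hty.symm
  have hymem : (y : B) ∈ Ideal.span (Set.range fun i => (g i : B)) := by
    rw [hy, Finsupp.sum, AddSubmonoidClass.coe_finsetSum]
    refine Submodule.sum_mem _ fun i _ => ?_
    rw [Submodule.coe_smul_of_tower, Algebra.smul_def]
    exact Ideal.mul_mem_left _ _ (Ideal.subset_span ⟨i, rfl⟩)
  have hx' : x = (y : B) + (x - y) := by ring
  rw [hx']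
  exact Submodule.add_mem_sup hymem hxy

/-- If `𝔪_x ⊆ J + 𝔪_x²` with `J ⊆ 𝔪_x`, then `𝔪_x` is a minimal prime of `J` (Nakayama in the
domains `B/𝔮`, `J ⊆ 𝔮 ⊆ 𝔪_x`). [folklore] -/
lemma pointIdeal_mem_minimalPrimes [IsNoetherianRing B] {J : Ideal B} (hJ : J ≤ pointIdeal φ)
    (hle : pointIdeal φ ≤ J ⊔ pointIdeal φ ^ 2) : pointIdeal φ ∈ J.minimalPrimes := by
  refine ⟨⟨(isMaximal_pointIdeal φ).isPrime, hJ⟩, ?_⟩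
  rintro q ⟨hq, hJq⟩ hqI
  -- in `B/q`, the image `I'` of `𝔪_x` satisfies `I' ≤ I'²`, hence `I' = 0` by Nakayama
  set I := pointIdeal φ with hI
  let π := Ideal.Quotient.mk q
  haveI : IsDomain (B ⧸ q) := Ideal.Quotient.isDomain q
  set I' : Ideal (B ⧸ q) := I.map π with hI'
  have hJ0 : J.map π = ⊥ := by
    rw [Ideal.map_eq_bot_iff_le_ker, Ideal.mk_ker]; exact hJq
  have hI'le : I' ≤ I' • I' := by
    have h := Ideal.map_mono (f := π) hle
    rw [Ideal.map_sup, hJ0, bot_sup_eq, Ideal.map_pow, pow_two] at h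
    exact h
  have hfg : (I' : Submodule (B ⧸ q) (B ⧸ q)).FG := (IsNoetherian.noetherian I')
  obtain ⟨r, hr1, hr⟩ :=
    Submodule.exists_sub_one_mem_and_smul_eq_zero_of_fg_of_le_smul I' I' hfg hI'le
  have hI'bot : I' = ⊥ := by
    by_contra hne
    obtain ⟨y, hyI, hy0⟩ := Submodule.exists_mem_ne_zero_of_ne_bot hne
    have hry : r * y = 0 := hr y hyI
    have hr0 : r = 0 := (mul_eq_zero.1 hry).resolve_right hy0
    rw [hr0, zero_sub, neg_mem_iff] at hr1
    have htop : I' = ⊤ := (Ideal.eq_top_iff_one _).2 hr1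
    -- but `I ⊔ q = I ≠ ⊤`
    have h2 : I ⊔ q = ⊤ := by
      have h3 := congrArg (Ideal.comap π) htop
      rwa [hI', Ideal.comap_map_of_surjective π Ideal.Quotient.mk_surjective, Ideal.comap_top,
        ← RingHom.ker_eq_comap_bot, Ideal.mk_ker] at h3
    rw [sup_eq_left.2 hqI] at h2
    exact (isMaximal_pointIdeal φ).ne_top h2
  rw [hI', Ideal.map_eq_bot_iff_le_ker, Ideal.mk_ker] at hI'bot
  exact hI'bot

/-- **`dim_x X ≤ dim_k T_x X`** (Springer 4.3.3 (iii): "for any `x ∈ X` we have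
`dim_k T_x X ≥ e`"; here in the local form `height 𝔪_x ≤ dim_k Der_k(B, k_x)` for any
Noetherian `k`-algebra `B` and `k`-rational point `x`, from which the printed statement follows
for irreducible `X` at points where `height 𝔪_x = dim X`). Proof: `𝔪_x` is a minimal prime of
the ideal generated by lifts of a basis of `𝔪_x/𝔪_x²` (Nakayama), so Krull's height theorem
(Mathlib `Ideal.height_le_card_of_mem_minimalPrimes_span`) bounds `height 𝔪_x` by
`dim 𝔪_x/𝔪_x² = dim T_x` (4.1.4). [cite: SpringerLAG1998, Thm 4.3.3 (iii)] -/
theorem height_pointIdeal_le_finrank_pointDerivations [IsNoetherianRing B] :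
    (pointIdeal φ).height ≤ Module.finrank k (pointDerivations φ) := by
  haveI := finite_cotangent_pointIdeal φ
  set I := pointIdeal φ with hI
  let b := Module.finBasis k I.Cotangent
  choose g hg using fun i => I.toCotangent_surjective (b i)
  have hspan : Submodule.span k (Set.range fun i => I.toCotangent (g i)) = ⊤ := by
    have : (fun i => I.toCotangent (g i)) = b := funext hg
    rw [this]; exact b.span_eq
  have hle := pointIdeal_le_span_sup_sq φ g hspan
  have hJ : Ideal.span (Set.range fun i => (g i : B)) ≤ I :=
    Ideal.span_le.2 (by rintro _ ⟨i, rfl⟩; exact (g i).2)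
  have hmin := pointIdeal_mem_minimalPrimes φ hJ hle
  have hfin : (Set.range fun i => (g i : B)).Finite := Set.finite_range _
  calc I.height ≤ ((Set.range fun i => (g i : B)).ncard : ℕ∞) :=
        Ideal.height_le_card_of_mem_minimalPrimes_span hfin hmin
    _ ≤ (Fintype.card (Fin (Module.finrank k I.Cotangent)) : ℕ∞) := by
        have h : (Set.range fun i => (g i : B)).ncard ≤
            Fintype.card (Fin (Module.finrank k I.Cotangent)) := by
          rw [← Set.image_univ]
          refine (Set.ncard_image_le Set.finite_univ).trans ?_
          rw [Set.ncard_univ, Nat.card_eq_fintype_card]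
        exact_mod_cast h
    _ = Module.finrank k (pointDerivations φ) := by
        rw [Fintype.card_fin, finrank_pointDerivations_eq_finrank_cotangent]

/-- **4.3.3 (iii) in coordinates**: for an ideal `I ⊆ k[T_i]_{i ∈ σ}` (`σ` finite) and a zero
`a` of `I`, the height of the maximal ideal of `a` in `k[T]/I` is at most
`dim_k tangentSpaceAt I a`. [cite: SpringerLAG1998, Thm 4.3.3 (iii)] -/
theorem height_le_finrank_tangentSpaceAt {σ : Type*} [Fintype σ] (I : Ideal (MvPolynomial σ k))
    (a : σ → k) (ha : ∀ f ∈ I, MvPolynomial.eval a f = 0) :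
    (pointIdeal (pointOfZero I a ha)).height ≤ Module.finrank k (tangentSpaceAt I a) := by
  rw [← (tangentSpaceAtEquiv I a ha).finrank_eq]
  exact height_pointIdeal_le_finrank_pointDerivations (pointOfZero I a ha)

end EmbeddingDimension

end Literature.RingTheory.KrullDimension
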